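import Mathlib
import Summits.ResolutionOfSingularities.ResolutionOfSingularities.Theorems.WeightedInvariantDatumToEmbeddedQuotientSingularitiesSlice
import HarnessLib

/-!
# The degree-zero part of the slice is `R₀ ⊗ₖ κ`

Topic: `Summits/ResolutionOfSingularities/ResolutionOfSingularities/Theorems`. Helper file of the
stub `stub_quotientSingularities_of_regular` of the line `Sketch` of the crux
`Theses.WeightedInvariant.DatumToEmbedded` (statement `stmt-ResolutionOfSingularities-0572`).

In the setting of `…QuotientSingularitiesSlice` (graded `k`-algebra `R = ⨁_χ R_χ`, maximal ideal
`P` with residue field `κ`, lattice `M` with basis `bₗ` and homogeneous units `uₗ ∈ R_{bₗ}`, slice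
`S = (κ ⊗ₖ R) ⧸ (1 ⊗ uₗ - ūₗ ⊗ 1)ₗ` graded by `A = G ⧸ M`), the natural map
`θ : R₀ ⊗ₖ κ → S`, `r ⊗ c ↦ (c ⊗ r)‾` (`zeroToSlice`) is an isomorphism onto the degree-`0` part
`S₀` (`zeroEquiv`):
* its image is `S₀` (`range_zeroToSlice`): `S₀` is spanned by the classes of `c ⊗ r`, `r ∈ R_χ`,
  `χ ∈ M`, and `r = (r u^{-χ}) u^χ` with `r u^{-χ} ∈ R₀` and `(1 ⊗ u^χ)‾ = (ū^χ ⊗ 1)‾` a scalar;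
* it is injective (`zeroToSlice_injective`): the `k`-linear retraction
  `ρ : κ ⊗ₖ R → R₀ ⊗ₖ κ`, `c ⊗ r ↦ ∑_{χ ∈ M} r_χ u^{-χ} ⊗ c ū^χ` (`retraction`) kills the ideal
  of the slice (`retraction_mul_sliceGen`) and is a left inverse of `θ` on `R₀ ⊗ₖ κ`.
Geometrically: the invariant part of the fibre of `Spec R → 𝔾ₘᵐ` over a `κ`-point is the base
change to `κ` of the quotient `Spec R₀` (the orbits over `Spec R₀` being single torsors under
`𝔾ₘᵐ` modulo the finite stabiliser). Consequently `S₀` is an ÉTALE `R₀`-algebra when `κ ⁄ k` is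
finite separable (`…QuotientSingularitiesSliceCore`).

Only Mathlib and the sibling helper files are used.
-/

-- the summit namespace repeats `ResolutionOfSingularities` by design (mandated namespace)
set_option linter.dupNamespace false

namespace Summit.ResolutionOfSingularities.ResolutionOfSingularities.Theorems.DatumToEmbedded.QuotientSingularities

open DirectSum TensorProduct Literature.RingTheory.GradedAlgebra

section Zero

variable {k : Type} [Field k] {R : Type} [CommRing R] [Algebra k R]
  {G : Type} [AddCommGroup G] [DecidableEq G] (𝓡 : G → Submodule k R) [GradedAlgebra 𝓡]
  {κ : Type} [CommRing κ] [Algebra k κ] (π : R →ₐ[k] κ) (M : Submodule ℤ G)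
  {m : ℕ} (b : Module.Basis (Fin m) ℤ M) (u : Fin m → R)
  (hu : ∀ l, u l ∈ 𝓡 (b l)) (hunit : ∀ l, IsUnit (u l))

/-! ## The map `R₀ ⊗ₖ κ → S` and its image -/

omit [DecidableEq G] [GradedAlgebra 𝓡] in
/-- Scalars of `κ` act on `κ ⊗ₖ R` through `c ⊗ 1`. [folklore] -/
theorem smul_eq_tmul_one_mul (c : κ) (x : κ ⊗[k] R) : c • x = (c ⊗ₜ[k] (1 : R)) * x := by
  induction x using TensorProduct.induction_on with
  | zero => rw [smul_zero, mul_zero]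
  | add x y hx hy => rw [smul_add, mul_add, hx, hy]
  | tmul c' r => rw [smul_tmul', smul_eq_mul, Algebra.TensorProduct.tmul_mul_tmul, one_mul]

variable (k) in
/-- The inclusion `R₀ → R` as a `k`-algebra map. [folklore] -/
def zeroVal : 𝓡 0 →ₐ[k] R := (SetLike.GradeZero.subalgebra 𝓡).val

/-- The map `R₀ ⊗ₖ κ → κ ⊗ₖ R`, `r ⊗ c ↦ c ⊗ r`. [folklore] -/
noncomputable def zeroToBase : (𝓡 0) ⊗[k] κ →ₐ[k] κ ⊗[k] R :=
  Algebra.TensorProduct.lift (Algebra.TensorProduct.includeRight.comp (zeroVal k 𝓡))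
    Algebra.TensorProduct.includeLeft fun _ _ => Commute.all _ _

/-- Unfolding `zeroToBase` on pure tensors. [folklore] -/
theorem zeroToBase_tmul (x : 𝓡 0) (c : κ) : zeroToBase 𝓡 (x ⊗ₜ c) = c ⊗ₜ (x : R) := by
  rw [zeroToBase, Algebra.TensorProduct.lift_tmul]
  change ((1 : κ) ⊗ₜ[k] (x : R)) * (c ⊗ₜ[k] (1 : R)) = _
  rw [Algebra.TensorProduct.tmul_mul_tmul, one_mul, mul_one]

/-- **The map `θ : R₀ ⊗ₖ κ → S`**, `r ⊗ c ↦ (c ⊗ r)‾`. [folklore] -/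
noncomputable def zeroToSlice : (𝓡 0) ⊗[k] κ →ₐ[k] Slice k π u :=
  (Ideal.Quotient.mkₐ k (sliceIdeal k π u)).comp (zeroToBase 𝓡)

/-- Unfolding `θ` on pure tensors. [folklore] -/
theorem zeroToSlice_tmul (x : 𝓡 0) (c : κ) :
    zeroToSlice 𝓡 π u (x ⊗ₜ c) = Ideal.Quotient.mk (sliceIdeal k π u) (c ⊗ₜ (x : R)) := by
  change Ideal.Quotient.mk _ (zeroToBase 𝓡 (x ⊗ₜ c)) = _
  rw [zeroToBase_tmul]

/-- `θ (x ⊗ 1) = (1 ⊗ x)‾`. [folklore] -/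
theorem zeroToSlice_tmul_one (x : 𝓡 0) : zeroToSlice 𝓡 π u (x ⊗ₜ 1) = toSlice k π u x :=
  zeroToSlice_tmul 𝓡 π u x 1

/-- `θ (1 ⊗ c) = (c ⊗ 1)‾`. [folklore] -/
theorem zeroToSlice_one_tmul (c : κ) :
    zeroToSlice 𝓡 π u (1 ⊗ₜ c) = Ideal.Quotient.mk (sliceIdeal k π u) (c ⊗ₜ (1 : R)) :=
  zeroToSlice_tmul 𝓡 π u 1 c

/-- The image of `θ` lies in the degree-`0` part of the slice. [folklore] -/
theorem zeroToSlice_mem (x : (𝓡 0) ⊗[k] κ) :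
    zeroToSlice 𝓡 π u x ∈ slicePiece k 𝓡 π M b u hu 0 := by
  induction x using TensorProduct.induction_on with
  | zero => rw [map_zero]; exact zero_mem _
  | add x y hx hy => rw [map_add]; exact add_mem hx hy
  | tmul x c =>
    rw [zeroToSlice_tmul]
    exact mk_mem_quotGrading (tmul_mem_coarsePiece_zero M.zero_mem c x.2)

include hunit in
/-- **The image of `θ` is the degree-`0` part of the slice**: `S₀` is spanned by the classes of
`c ⊗ r` with `r ∈ R_χ`, `χ ∈ M`, and `(c ⊗ r)‾ = θ(r u^{-χ} ⊗ c ū^χ)`. [folklore] -/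
theorem mem_range_zeroToSlice {s : Slice k π u} (hs : s ∈ slicePiece k 𝓡 π M b u hu 0) :
    s ∈ (zeroToSlice 𝓡 π u).range := by
  obtain ⟨p, hp, rfl⟩ := mem_quotGrading_iff.1 hs
  clear hs
  change Ideal.Quotient.mk (sliceIdeal k π u) p ∈ (zeroToSlice 𝓡 π u).range
  change p ∈ ⨆ χ ∈ {χ | M.mkQ.toAddMonoidHom χ = 0}, basePiece 𝓡 χ at hp
  -- reduce to `p ∈ κ ⊗ R_χ` with `χ ∈ M`
  induction hp using Submodule.iSup_induction' with
  | zero => rw [map_zero]; exact zero_mem _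
  | add x y _ _ hx hy => rw [map_add]; exact add_mem hx hy
  | mem χ p hp =>
    by_cases hχ : χ ∈ M
    · rw [iSup_pos (show χ ∈ {χ | M.mkQ.toAddMonoidHom χ = 0} from
        (Submodule.Quotient.mk_eq_zero M).2 hχ)] at hp
      change p ∈ (𝓡 χ).baseChange κ at hp
      rw [Submodule.baseChange_eq_span] at hp
      -- reduce to `p = 1 ⊗ r` with `r ∈ R_χ`
      induction hp using Submodule.span_induction with
      | zero => rw [map_zero]; exact zero_mem _
      | add x y _ _ hx hy => rw [map_add]; exact add_mem hx hy
      | smul c x _ hx =>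
        rw [smul_eq_tmul_one_mul, map_mul, ← zeroToSlice_one_tmul 𝓡 π u]
        exact mul_mem ⟨_, rfl⟩ hx
      | mem x hx =>
        obtain ⟨r, hr, rfl⟩ := hx
        change r ∈ 𝓡 χ at hr
        change Ideal.Quotient.mk _ ((1 : κ) ⊗ₜ[k] r) ∈ _
        -- `r = (r u^{-χ}) u^χ`
        set V := unitSection M b u hunit ⟨χ, hχ⟩ with hV
        have hVmem : (V : R) ∈ 𝓡 χ := val_unitSection_mem 𝓡 M b u hunit hu ⟨χ, hχ⟩
        have hr0 : r * ↑V⁻¹ ∈ 𝓡 0 := by simpa using SetLike.mul_mem_graded hr (val_inv_mem hVmem)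
        have hr' : r = (r * ↑V⁻¹) * V := by rw [mul_assoc, Units.inv_mul, mul_one]
        rw [hr', ← toSlice_apply, map_mul, toSlice_unitSection, toSliceLeft_apply,
          ← zeroToSlice_one_tmul 𝓡 π u, ← zeroToSlice_tmul_one 𝓡 π u ⟨_, hr0⟩, ← map_mul]
        exact ⟨_, rfl⟩
    · rw [iSup_neg (show χ ∉ {χ | M.mkQ.toAddMonoidHom χ = 0} from
        fun h => hχ ((Submodule.Quotient.mk_eq_zero M).1 h)), Submodule.mem_bot] at hp
      rw [hp, map_zero]
      exact zero_mem _

/-! ## The retraction `κ ⊗ₖ R → R₀ ⊗ₖ κ` -/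

/-- Multiplication by `u^{-χ}`, `R_χ → R₀` (`χ ∈ M`). [folklore] -/
noncomputable def mulInvSection (χ : M) : 𝓡 (χ : G) →ₗ[k] 𝓡 0 where
  toFun x := ⟨x * ↑(unitSection M b u hunit χ)⁻¹, by
    simpa using SetLike.mul_mem_graded x.2 (val_inv_mem (val_unitSection_mem 𝓡 M b u hunit hu χ))⟩
  map_add' x y := Subtype.ext (add_mul _ _ _)
  map_smul' a x := Subtype.ext (smul_mul_assoc _ _ _)

open Classical in
/-- The retraction on the piece `R_χ`: `r ↦ (c ↦ r u^{-χ} ⊗ c ū^χ)` for `χ ∈ M`, zero otherwise.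
[folklore] -/
noncomputable def retractPiece (χ : G) : 𝓡 χ →ₗ[k] (κ →ₗ[k] (𝓡 0) ⊗[k] κ) :=
  if h : χ ∈ M then
    ((TensorProduct.mk k (𝓡 0) κ).compl₂
        (LinearMap.mulRight k (π (unitSection M b u hunit ⟨χ, h⟩ : R)))) ∘ₗ
      mulInvSection 𝓡 M b u hu hunit ⟨χ, h⟩
  else 0

/-- **The retraction** `ρ : κ ⊗ₖ R → R₀ ⊗ₖ κ`, `c ⊗ r ↦ ∑_{χ ∈ M} r_χ u^{-χ} ⊗ c ū^χ`
(`k`-linear, not multiplicative). [folklore] -/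
noncomputable def retraction : κ ⊗[k] R →ₗ[k] (𝓡 0) ⊗[k] κ :=
  TensorProduct.lift
    (DirectSum.toModule k G _ (retractPiece 𝓡 π M b u hu hunit) ∘ₗ
      (DirectSum.decomposeLinearEquiv 𝓡).toLinearMap).flip

/-- The retraction on `c ⊗ r`, `r ∈ R_χ`, `χ ∈ M`. [folklore] -/
theorem retraction_tmul_of_mem {χ : G} (hχ : χ ∈ M) (c : κ) {r : R} (hr : r ∈ 𝓡 χ) :
    retraction 𝓡 π M b u hu hunit (c ⊗ₜ r) =
      mulInvSection 𝓡 M b u hu hunit ⟨χ, hχ⟩ ⟨r, hr⟩ ⊗ₜ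
        (c * π (unitSection M b u hunit ⟨χ, hχ⟩ : R)) := by
  classical
  have h1 : (DirectSum.decomposeLinearEquiv 𝓡).toLinearMap r =
      DirectSum.lof k G (fun χ => 𝓡 χ) χ ⟨r, hr⟩ := by
    rw [DirectSum.lof_eq_of]
    exact decompose_of_mem 𝓡 hr
  rw [retraction, TensorProduct.lift.tmul, LinearMap.flip_apply, LinearMap.comp_apply, h1,
    DirectSum.toModule_lof, retractPiece, dif_pos hχ]
  rfl

/-- The retraction kills `c ⊗ r`, `r ∈ R_χ`, `χ ∉ M`. [folklore] -/
theorem retraction_tmul_of_not_mem {χ : G} (hχ : χ ∉ M) (c : κ) {r : R} (hr : r ∈ 𝓡 χ) :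
    retraction 𝓡 π M b u hu hunit (c ⊗ₜ r) = 0 := by
  classical
  have h1 : (DirectSum.decomposeLinearEquiv 𝓡).toLinearMap r =
      DirectSum.lof k G (fun χ => 𝓡 χ) χ ⟨r, hr⟩ := by
    rw [DirectSum.lof_eq_of]
    exact decompose_of_mem 𝓡 hr
  rw [retraction, TensorProduct.lift.tmul, LinearMap.flip_apply, LinearMap.comp_apply, h1,
    DirectSum.toModule_lof, retractPiece, dif_neg hχ]
  rfl

/-- The retraction is a left inverse of `R₀ ⊗ₖ κ → κ ⊗ₖ R`. [folklore] -/
theorem retraction_zeroToBase (x : (𝓡 0) ⊗[k] κ) :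
    retraction 𝓡 π M b u hu hunit (zeroToBase 𝓡 x) = x := by
  induction x using TensorProduct.induction_on with
  | zero => rw [map_zero, map_zero]
  | add x y hx hy => rw [map_add, map_add, hx, hy]
  | tmul x c =>
    rw [zeroToBase_tmul, retraction_tmul_of_mem 𝓡 π M b u hu hunit M.zero_mem c x.2]
    have h0 : unitSection M b u hunit ⟨0, M.zero_mem⟩ = 1 := unitSection_zero M b u hunit
    congr 1
    · refine Subtype.ext ?_
      change (x : R) * ↑(unitSection M b u hunit ⟨0, M.zero_mem⟩)⁻¹ = x
      rw [h0, inv_one, Units.val_one, mul_one]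
    · rw [h0, Units.val_one, map_one, mul_one]

/-- **The retraction kills the ideal of the slice**: on `(c ⊗ r)(1 ⊗ uₗ - ūₗ ⊗ 1)` with `r ∈ R_χ`
both terms are `r u^{-χ} ⊗ c ūₗ ū^χ` if `χ ∈ M` (as `u^{χ + bₗ} = u^χ uₗ`) and `0` otherwise.
[folklore] -/
theorem retraction_mul_sliceGen (p : κ ⊗[k] R) (l : Fin m) :
    retraction 𝓡 π M b u hu hunit (p * sliceGen k u (resUnit π u) l) = 0 := by
  induction p using TensorProduct.induction_on with
  | zero => rw [zero_mul, map_zero]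
  | add x y hx hy => rw [add_mul, map_add, hx, hy, add_zero]
  | tmul c r =>
    induction r using DirectSum.Decomposition.inductionOn 𝓡 with
    | zero => rw [tmul_zero, zero_mul, map_zero]
    | add r r' hr hr' => rw [tmul_add, add_mul, map_add, hr, hr', add_zero]
    | homogeneous r =>
      obtain ⟨r, hrm⟩ := r
      rename_i χ
      change retraction 𝓡 π M b u hu hunit
        ((c ⊗ₜ[k] r) * ((1 : κ) ⊗ₜ u l - resUnit π u l ⊗ₜ (1 : R))) = 0
      rw [mul_sub, Algebra.TensorProduct.tmul_mul_tmul, Algebra.TensorProduct.tmul_mul_tmul,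
        mul_one, mul_one, map_sub, sub_eq_zero]
      by_cases hχ : χ ∈ M
      · have hχl : χ + (b l : G) ∈ M := M.add_mem hχ (b l).2
        rw [retraction_tmul_of_mem 𝓡 π M b u hu hunit hχl c (SetLike.mul_mem_graded hrm (hu l)),
          retraction_tmul_of_mem 𝓡 π M b u hu hunit hχ _ hrm]
        have hV : unitSection M b u hunit ⟨χ + (b l : G), hχl⟩ =
            unitSection M b u hunit ⟨χ, hχ⟩ * unitSection M b u hunit (b l) := by
          rw [← unitSection_add]
          rfl
        congr 1
        · refine Subtype.ext ?_
          change r * u l * ↑(unitSection M b u hunit ⟨χ + (b l : G), hχl⟩)⁻¹ =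
            r * ↑(unitSection M b u hunit ⟨χ, hχ⟩)⁻¹
          rw [hV, mul_inv, Units.val_mul, ← coe_unitSection_basis M b u hunit l]
          rw [mul_assoc, mul_left_comm (unitSection M b u hunit (b l) : R), Units.mul_inv, mul_one]
        · rw [hV, Units.val_mul, map_mul, coe_unitSection_basis]
          change c * (_ * π (u l)) = c * π (u l) * _
          ring
      · have hχl : χ + (b l : G) ∉ M := fun h => hχ (by simpa using M.sub_mem h (b l).2)
        rw [retraction_tmul_of_not_mem 𝓡 π M b u hu hunit hχl c (SetLike.mul_mem_graded hrm (hu l)),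
          retraction_tmul_of_not_mem 𝓡 π M b u hu hunit hχ _ hrm]

/-- The retraction kills the ideal of the slice. [folklore] -/
theorem retraction_eq_zero_of_mem {p : κ ⊗[k] R} (hp : p ∈ sliceIdeal k π u) :
    retraction 𝓡 π M b u hu hunit p = 0 := by
  obtain ⟨c, rfl⟩ := Ideal.mem_span_range_iff_exists_fun.1 hp
  rw [map_sum]
  exact Finset.sum_eq_zero fun l _ => retraction_mul_sliceGen 𝓡 π M b u hu hunit (c l) l

include M b hu hunit in
/-- **`θ : R₀ ⊗ₖ κ → S` is injective.** [folklore] -/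
theorem zeroToSlice_injective : Function.Injective (zeroToSlice 𝓡 π u) := by
  rw [injective_iff_map_eq_zero]
  intro x hx
  have hx' : zeroToBase 𝓡 x ∈ sliceIdeal k π u := Ideal.Quotient.eq_zero_iff_mem.1 hx
  rw [← retraction_zeroToBase 𝓡 π M b u hu hunit x,
    retraction_eq_zero_of_mem 𝓡 π M b u hu hunit hx']

/-! ## `S₀ ≅ R₀ ⊗ₖ κ` as `R₀`-algebras -/

variable [DecidableEq (G ⧸ M)]

/-- `θ` corestricted to the degree-`0` part of the slice. [folklore] -/
noncomputable def zeroToSliceZero : (𝓡 0) ⊗[k] κ →ₐ[k] slicePiece k 𝓡 π M b u hu 0 :=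
  (zeroToSlice 𝓡 π u).codRestrict (SetLike.GradeZero.subalgebra (slicePiece k 𝓡 π M b u hu))
    (zeroToSlice_mem 𝓡 π M b u hu)

/-- **The degree-`0` part of the slice is `R₀ ⊗ₖ κ`**: `θ` is an isomorphism of `k`-algebras
`R₀ ⊗ₖ κ ≃ S₀`. [folklore] -/
noncomputable def zeroEquiv : (𝓡 0) ⊗[k] κ ≃ₐ[k] slicePiece k 𝓡 π M b u hu 0 :=
  AlgEquiv.ofBijective (zeroToSliceZero 𝓡 π M b u hu)
    ⟨fun x y hxy => zeroToSlice_injective 𝓡 π M b u hu hunit (congrArg Subtype.val hxy),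
      fun s => by
        obtain ⟨x, hx⟩ := mem_range_zeroToSlice 𝓡 π M b u hu hunit s.2
        exact ⟨x, Subtype.ext hx⟩⟩

/-- `S₀` as an `R₀`-algebra, through `θ`. [folklore] -/
@[reducible] noncomputable def zeroAlgebra : Algebra (𝓡 0) (slicePiece k 𝓡 π M b u hu 0) :=
  ((zeroToSliceZero 𝓡 π M b u hu).toRingHom.comp
    (Algebra.TensorProduct.includeLeftRingHom (R := k) (A := 𝓡 0) (B := κ))).toAlgebra

/-- The structure map `R₀ → S₀` followed by `S₀ ⊆ S` is `r ↦ (1 ⊗ r)‾`. [folklore] -/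
theorem coe_algebraMap_zero (x : 𝓡 0) :
    letI := zeroAlgebra 𝓡 π M b u hu
    (algebraMap (𝓡 0) (slicePiece k 𝓡 π M b u hu 0) x : Slice k π u) = toSlice k π u x :=
  zeroToSlice_tmul_one 𝓡 π u x

/-- `k → R₀ → S₀` is the structure map of `S₀`. [folklore] -/
theorem isScalarTower_zero :
    letI := zeroAlgebra 𝓡 π M b u hu
    IsScalarTower k (𝓡 0) (slicePiece k 𝓡 π M b u hu 0) := by
  letI := zeroAlgebra 𝓡 π M b u hu
  refine IsScalarTower.of_algebraMap_eq (R := k) (S := 𝓡 0)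
    (A := slicePiece k 𝓡 π M b u hu 0) fun c => ?_
  change algebraMap k _ c = zeroToSliceZero 𝓡 π M b u hu
    ((Algebra.TensorProduct.includeLeft : 𝓡 0 →ₐ[k] (𝓡 0) ⊗[k] κ) (algebraMap k (𝓡 0) c))
  rw [AlgHom.commutes, AlgHom.commutes]

include hunit in
/-- **`S₀` is étale over `R₀`** as soon as `κ` is étale over `k` (e.g. `κ ⁄ k` finite separable):
it is `R₀ ⊗ₖ κ`. [folklore] -/
theorem etale_zero [Algebra.Etale k κ] :
    letI := zeroAlgebra 𝓡 π M b u hu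
    Algebra.Etale (𝓡 0) (slicePiece k 𝓡 π M b u hu 0) := by
  letI := zeroAlgebra 𝓡 π M b u hu
  exact Algebra.Etale.of_equiv (A := (𝓡 0) ⊗[k] κ)
    { (zeroEquiv 𝓡 π M b u hu hunit).toRingEquiv with commutes' := fun _ => rfl }

end Zero

/-! ## Registered form -/

/-- **Registered sub-goal `stub_qs_sliceZero`** of the crux (helper of the stub
`stub_quotientSingularities_of_regular`): `θ : R₀ ⊗ₖ κ → S` is injective with image the
degree-`0` part of the slice. [folklore] -/
theorem stub_qs_sliceZero :
    ∀ {k : Type} [Field k] {R : Type} [CommRing R] [Algebra k R] {G : Type} [AddCommGroup G]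
      [DecidableEq G] (𝓡 : G → Submodule k R) [GradedAlgebra 𝓡] {κ : Type} [CommRing κ]
      [Algebra k κ] (π : R →ₐ[k] κ) (M : Submodule ℤ G) {m : ℕ} (b : Module.Basis (Fin m) ℤ M)
      (u : Fin m → R) (hu : ∀ l, u l ∈ 𝓡 (b l)), (∀ l, IsUnit (u l)) →
      Function.Injective
          (Summit.ResolutionOfSingularities.ResolutionOfSingularities.Theorems.DatumToEmbedded.QuotientSingularities.zeroToSlice
            𝓡 π u) ∧
        ∀ s, s ∈
          Summit.ResolutionOfSingularities.ResolutionOfSingularities.Theorems.DatumToEmbedded.QuotientSingularities.slicePiece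
            k 𝓡 π M b u hu 0 ↔
          s ∈ (Summit.ResolutionOfSingularities.ResolutionOfSingularities.Theorems.DatumToEmbedded.QuotientSingularities.zeroToSlice
            𝓡 π u).range :=
  fun {_} _ {_} _ _ {_} _ _ 𝓡 _ {_} _ _ π M {_} b u hu hunit =>
    ⟨zeroToSlice_injective 𝓡 π M b u hu hunit, fun _ =>
      ⟨mem_range_zeroToSlice 𝓡 π M b u hu hunit, fun ⟨x, hx⟩ => hx ▸ zeroToSlice_mem 𝓡 π M b u hu x⟩⟩

end Summit.ResolutionOfSingularities.ResolutionOfSingularities.Theorems.DatumToEmbedded.QuotientSingularities
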